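import Literature.AlgebraicGeometry.HodgeTheory.AtiyahPowers
import HarnessLib

/-!
# Naturality of the torsion-safe Atiyah class `atiyahClass'` in the module

`HodgeTheory/AtiyahClassCoherent.lean` constructs, for ANY `𝒪_X`-module `E` on an `S`-scheme
`X : Over (Spec S)`, the jet sequence `0 → 𝓗om(𝒯, E) → P¹(E) → E → 0` (`𝒯 = (Ω¹_{X/S})^∨`) and its
Yoneda class `atiyahClass' E ∈ Ext¹(E, 𝓗om(𝒯, E))`. Here we prove that the construction is
FUNCTORIAL in `E` (Atiyah 1957, Prop. 6–7: `D(E)` and `b(E)` are functorial; Buchweitz–Flenner §3):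

* `jetMapCoh f : P¹(E) → P¹(E')` for `f : E → E'`, `(s, φ) ↦ (f s, φ ≫ f|)` — `𝒪_X`-linear for the
  twisted structures because the twisting term `θ ↦ θ(da) s` is natural in `s`;
* `jetShortComplexCohMap f` — the morphism of Atiyah sequences over `f` and `𝓗om(𝒯, f)`;
* **`atiyahClass'_naturality`**: `At'(E) · 𝓗om(𝒯, f) = f · At'(E')` in `Ext¹(E, 𝓗om(𝒯, E'))`
  (naturality of Mathlib's `ShortExact.extClass`);
* `multiHomMap f k : multiHom 𝒯 E k → multiHom 𝒯 E' k` (the functor `𝓗om(𝒯, –)` iterated `k` times on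
  `f`; `multiHomMap_id`, `multiHomMap_comp`) and **`atiyahPow_naturality`**:
  `At'(E)^k · multiHomMap f k = f · At'(E')^k` in `Extᵏ(E, multiHom 𝒯 E' k)` for the Yoneda powers of
  `HodgeTheory/AtiyahPowers.lean` (induction on `k`: the exact functor `𝓗om(𝒯, –)` commutes with
  Yoneda composition, Mathlib `Ext.mapExactFunctor_comp` / `mapExactFunctor_mk₀`), with the corollary
  `atiyahPowComp_naturality` for `x ⋆ At'(E)^k`, `x ∈ Extⁿ(E'', E)`.

This is the compatibility needed to transport `atiyahClass'` along the differentials of a locally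
free resolution (the chain-map property of Illusie's trace, Buchweitz–Flenner §4) and along the
biduality map `E → E^∨∨`. Not here: the comparison with `atiyahClass E` of `AtiyahClass.lean`
through the transpose `𝓗om(E^∨, Ω¹) → 𝓗om(𝒯, E^∨∨)` (its section-level construction over the opens
of `U`, a morphism `(Ω¹)^∨|_U → E^∨∨|_U` for a LOCAL section `φ`, is the missing piece).

## References

* M. F. Atiyah, *Complex analytic connections in fibre bundles*, Trans. AMS 85 (1957), §4,
  Prop. 6–7. [Atiyah1957]
* R.-O. Buchweitz, H. Flenner, Compositio Math. 137 (2003), §3 (Atiyah class), §4. [BuchweitzFlenner2003]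
-/

noncomputable section

open CategoryTheory CategoryTheory.Abelian AlgebraicGeometry Opposite TopologicalSpace Limits

namespace Literature.AlgebraicGeometry.HodgeTheory

open Literature.AlgebraicGeometry.Modules Literature.AlgebraicGeometry.Motives

universe w u

/-! ### Generalities on restricted morphisms (any scheme) -/

section Over

variable {Y : Scheme.{u}} {M N : Y.Modules} {U : Y.Opens}

/-- `smulSection s ≫ f|_U = smulSection (f s)`: multiplying by a section and then applying a
morphism of modules is multiplying by the image section. [folklore] -/
private lemma smulSection_comp_over_map (f : M ⟶ N) (s : Γ(M, U)) :
    smulSection s ≫ (SheafOfModules.overFunctor _ U).map f = smulSection (f.app U s) :=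
  hom_ext_of_appLE fun W k (r : Γ(Y, W)) => by
    rw [appLE_comp, appLE_over_map, appLE_smulSection, appLE_smulSection,
      Scheme.Modules.Hom.app_smul]
    exact congrArg (r • ·) (PresheafOfModules.naturality_apply f.val k.op s)

end Over

/-! ### Functoriality of the torsion-safe jet module and naturality of `atiyahClass'` -/

section Naturality

variable {S : Type u} [CommRing S] {X : Over (Spec (CommRingCat.of S))}
variable {E E' : X.left.Modules} (f : E ⟶ E') {U : X.left.Opens}

/-- Extensionality for torsion-safe jet sections (local copy; the library's is private). [folklore] -/
private lemma jetSectionsCoh_ext {F : X.left.Modules} {p q : JetSectionsCoh F U}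
    (h₁ : p.fst = q.fst) (h₂ : p.snd = q.snd) : p = q :=
  Prod.ext h₁ h₂

/-- The twisting term is natural: `δ'(a, s) ≫ f| = δ'(a, f s)`. [folklore] -/
private lemma deltaHomCoh_comp_over_map (a : Γ(X.left, U)) (s : Γ(E, U)) :
    deltaHomCoh E U a s ≫ (SheafOfModules.overFunctor _ U).map f =
      deltaHomCoh E' U a (f.app U s) := by
  rw [deltaHomCoh, deltaHomCoh, Category.assoc, smulSection_comp_over_map]

/-- **Functoriality of `P¹`**: a morphism `f : E → E'` induces `P¹(E) → P¹(E')`,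
`(s, φ) ↦ (f s, φ ≫ f|)` — `𝒪_X`-linear for the twisted structures because the twisting term is
natural. [cite: Atiyah1957, Prop. 6 (functoriality of D(E))] -/
def jetMapCoh : jetModuleCoh E ⟶ jetModuleCoh E' where
  val := PresheafOfModules.homMk
    { app := fun U => AddCommGrpCat.ofHom
        { toFun := fun p : JetSectionsCoh E U.unop =>
            (JetSectionsCoh.mk (f.app U.unop p.fst)
              (p.snd ≫ (SheafOfModules.overFunctor _ U.unop).map f) : JetSectionsCoh E' U.unop)
          map_zero' := jetSectionsCoh_ext (map_zero (f.app U.unop).hom)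
            (zero_comp (X := (tangentSheaf X).over U.unop))
          map_add' := fun p q => jetSectionsCoh_ext (map_add (f.app U.unop).hom p.fst q.fst)
            (Preadditive.add_comp _ _ _ p.snd q.snd _) }
      naturality := fun {U V} i =>
        AddCommGrpCat.ext fun (p : JetSectionsCoh E U.unop) => jetSectionsCoh_ext
          (PresheafOfModules.naturality_apply f.val i p.fst)
          (by
            change restrictHom i.unop p.snd ≫ _ = restrictHom i.unop (p.snd ≫ _)
            rw [restrictHom_comp, restrictHom_over_map]) }
    (fun U (a : Γ(X.left, U.unop)) (p : JetSectionsCoh E U.unop) => jetSectionsCoh_ext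
      (Scheme.Modules.Hom.app_smul f a p.fst)
      (by
        change (a • p.snd + deltaHomCoh E U.unop a p.fst) ≫ _ =
          a • (p.snd ≫ _) + deltaHomCoh E' U.unop a (f.app U.unop p.fst)
        rw [Preadditive.add_comp, smul_comp_overHom, deltaHomCoh_comp_over_map]))

/-- **The morphism of Atiyah sequences induced by `f : E → E'`** (over `f` and `𝓗om(𝒯, f)`).
[cite: Atiyah1957, Prop. 6 (functoriality of the extension 𝔅(E))] -/
def jetShortComplexCohMap : jetShortComplexCoh E ⟶ jetShortComplexCoh E' where
  τ₁ := sheafHomMap (tangentSheaf X) f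
  τ₂ := jetMapCoh f
  τ₃ := f
  comm₁₂ := Scheme.Modules.hom_ext _ _ fun U => AddCommGrpCat.ext
    fun (_ : (tangentSheaf X).over U ⟶ E.over U) => jetSectionsCoh_ext
      (map_zero (f.app U).hom).symm rfl
  comm₂₃ := Scheme.Modules.hom_ext _ _ fun U => AddCommGrpCat.ext fun (_ : JetSectionsCoh E U) => rfl

variable [HasExt.{w} X.left.Modules]

/-- **Naturality of the torsion-safe Atiyah class**: for `f : E → E'`,
`At'(E) · 𝓗om(𝒯, f) = f · At'(E')` in `Ext¹(E, 𝓗om(𝒯, E'))` (naturality of `ShortExact.extClass`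
along `jetShortComplexCohMap f`). [cite: Atiyah1957, Prop. 7 (b(E) is functorial)] [cite: BuchweitzFlenner2003, §3 (Atiyah class)] -/
theorem atiyahClass'_naturality :
    (atiyahClass' E).comp (Ext.mk₀ (sheafHomMap (tangentSheaf X) f)) (add_zero 1) =
      (Ext.mk₀ f).comp (atiyahClass'.{w} E') (zero_add 1) :=
  (jetShortComplexCoh_shortExact E).extClass_naturality (jetShortComplexCoh_shortExact E')
    (jetShortComplexCohMap f)

end Naturality

/-! ### Naturality of the Yoneda powers `At'(E)^k` -/

section Powers

variable {S : Type u} [CommRing S] {X : Over (Spec (CommRingCat.of S))}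
variable {E E' E'' : X.left.Modules} (f : E ⟶ E') (g : E' ⟶ E'')

/-- **`multiHom 𝒯 (–) k` on morphisms**: `multiHomMap f k = 𝓗om(𝒯, 𝓗om(𝒯, … f …))`, the functor
`𝓗om(𝒯_{X/S}, –)` (`Modules.sheafHomFunctor`) applied `k` times to `f : E → E'` — the map induced on the
coefficients `E ⊗ (Ω¹)^{⊗k}` (torsion-safe model) by a morphism of modules. [cite: Hartshorne1977, II Ex. 5.1 (b) (functoriality of 𝓗om(–, –) in the second variable)] -/
def multiHomMap : (k : ℕ) → (multiHom (tangentSheaf X) E k ⟶ multiHom (tangentSheaf X) E' k)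
  | 0 => f
  | k + 1 => sheafHomMap (tangentSheaf X) (multiHomMap k)

/-- `multiHomMap f 0 = f`. [cite: Hartshorne1977, II.5 (p. 109: the sheaf 𝓗om, functorial in the second variable)] -/
@[simp]
lemma multiHomMap_zero : multiHomMap f 0 = f := rfl

/-- `multiHomMap f (k + 1) = 𝓗om(𝒯, multiHomMap f k)` (as `(sheafHomFunctor 𝒯).map`). [cite: Hartshorne1977, II.5 (p. 109: the sheaf 𝓗om, functorial in the second variable)] -/
lemma multiHomMap_succ (k : ℕ) :
    multiHomMap f (k + 1) = (sheafHomFunctor (tangentSheaf X)).map (multiHomMap f k) := rfl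

/-- `multiHomMap (𝟙 E) k = 𝟙` (`𝓗om(𝒯, –)^k` is a functor). [cite: Hartshorne1977, II.5 (p. 109: the sheaf 𝓗om, functorial in the second variable)] -/
@[simp]
lemma multiHomMap_id : (k : ℕ) → multiHomMap (𝟙 E) k = 𝟙 (multiHom (tangentSheaf X) E k)
  | 0 => rfl
  | k + 1 => by
    rw [multiHomMap_succ, multiHomMap_id k]
    exact CategoryTheory.Functor.map_id _ _

/-- `multiHomMap (f ≫ g) k = multiHomMap f k ≫ multiHomMap g k` (`𝓗om(𝒯, –)^k` is a functor). [cite: Hartshorne1977, II.5 (p. 109: the sheaf 𝓗om, functorial in the second variable)] -/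
lemma multiHomMap_comp : (k : ℕ) → multiHomMap (f ≫ g) k = multiHomMap f k ≫ multiHomMap g k
  | 0 => rfl
  | k + 1 => by
    rw [multiHomMap_succ, multiHomMap_succ, multiHomMap_succ, multiHomMap_comp k]
    exact CategoryTheory.Functor.map_comp _ _ _

variable (hΩ : IsFiniteLocallyFree (cotangentSheaf X)) [HasExt.{w} X.left.Modules]

/-- **Naturality of the powers of the torsion-safe Atiyah class**: for `f : E → E'` and every `k`,
`At'(E)^k · multiHomMap f k = f · At'(E')^k` in `Extᵏ(E, multiHom 𝒯 E' k)`. Induction on `k`: write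
`At^{k+1} = At ⋆ 𝓗om(𝒯, At^k)`; the exact functor `𝓗om(𝒯, –)` commutes with Yoneda composition
(`Ext.mapExactFunctor_comp`, `mapExactFunctor_mk₀`), so the claim for `k + 1` is `atiyahClass'_naturality`
followed by the claim for `k` inside `𝓗om(𝒯, –)`. (The steps are chained as term-mode equalities with
the `Ext` classes ascribed to the objects `(sheafHomFunctor 𝒯).obj _`, which are definitionally, not
syntactically, the `multiHom` / `twistTangentHom` objects.) [cite: BuchweitzFlenner2003, §1 and §3 (Atiyah class and its powers are functorial)] [cite: Atiyah1957, Prop. 7] -/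
theorem atiyahPow_naturality : (k : ℕ) →
    (atiyahPow hΩ E k).comp (Ext.mk₀ (multiHomMap f k)) (add_zero k) =
      (Ext.mk₀ f).comp (atiyahPow.{w} hΩ E' k) (zero_add k)
  | 0 => by
    change (Ext.mk₀ (𝟙 E)).comp (Ext.mk₀ f) (add_zero 0) =
      (Ext.mk₀ f).comp (Ext.mk₀ (𝟙 E')) (zero_add 0)
    rw [Ext.mk₀_comp_mk₀, Ext.mk₀_comp_mk₀, Category.id_comp, Category.comp_id]
  | k + 1 => by
    haveI := preservesFiniteColimits_sheafHomFunctor_tangentSheaf hΩ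
    let F := sheafHomFunctor (tangentSheaf X)
    -- the classes involved, ascribed to `F.obj`-objects
    let A : Ext.{w} E (F.obj E) 1 := atiyahClass' E
    let A' : Ext.{w} E' (F.obj E') 1 := atiyahClass' E'
    let P : Ext.{w} (F.obj E) (F.obj (multiHom (tangentSheaf X) E k)) k :=
      (atiyahPow hΩ E k).mapExactFunctor F
    let P' : Ext.{w} (F.obj E') (F.obj (multiHom (tangentSheaf X) E' k)) k :=
      (atiyahPow hΩ E' k).mapExactFunctor F
    let φ : Ext.{w} (F.obj (multiHom (tangentSheaf X) E k))
        (F.obj (multiHom (tangentSheaf X) E' k)) 0 :=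
      Ext.mk₀ (F.map (multiHomMap f k))
    let ψ : Ext.{w} (F.obj E) (F.obj E') 0 := Ext.mk₀ (F.map f)
    -- degree one: `atiyahClass'_naturality` (`F.map f = sheafHomMap 𝒯 f` definitionally)
    have nat₁ : A.comp ψ (add_zero 1) = (Ext.mk₀ f).comp A' (zero_add 1) :=
      atiyahClass'_naturality f
    -- degree `k` inside `𝓗om(𝒯, –)`: the induction hypothesis mapped by the exact functor `F`
    have natk : P.comp φ (add_zero k) = ψ.comp P' (zero_add k) :=
      calc P.comp φ (add_zero k)
          = P.comp ((Ext.mk₀ (multiHomMap f k)).mapExactFunctor F) (add_zero k) :=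
            congrArg (fun t => P.comp t (add_zero k))
              (Ext.mapExactFunctor_mk₀ F (multiHomMap f k)).symm
        _ = ((atiyahPow hΩ E k).comp (Ext.mk₀ (multiHomMap f k)) (add_zero k)).mapExactFunctor F :=
            (Ext.mapExactFunctor_comp F _ _ _).symm
        _ = ((Ext.mk₀ f).comp (atiyahPow.{w} hΩ E' k) (zero_add k)).mapExactFunctor F :=
            congrArg (fun t => Ext.mapExactFunctor F t) (atiyahPow_naturality k)
        _ = ((Ext.mk₀ f).mapExactFunctor F).comp P' (zero_add k) :=
            Ext.mapExactFunctor_comp F _ _ _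
        _ = ψ.comp P' (zero_add k) :=
            congrArg (fun t => Ext.comp t P' (zero_add k)) (Ext.mapExactFunctor_mk₀ F f)
    -- assemble
    calc (A.comp P (Nat.add_comm 1 k)).comp φ (add_zero (k + 1))
        = A.comp (P.comp φ (add_zero k)) (Nat.add_comm 1 k) :=
          Ext.comp_assoc_of_third_deg_zero A P φ (Nat.add_comm 1 k)
      _ = A.comp (ψ.comp P' (zero_add k)) (Nat.add_comm 1 k) :=
          congrArg (fun t => A.comp t (Nat.add_comm 1 k)) natk
      _ = (A.comp ψ (add_zero 1)).comp P' (Nat.add_comm 1 k) :=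
          (Ext.comp_assoc_of_second_deg_zero A ψ P' (Nat.add_comm 1 k)).symm
      _ = ((Ext.mk₀ f).comp A' (zero_add 1)).comp P' (Nat.add_comm 1 k) :=
          congrArg (fun t => Ext.comp t P' (Nat.add_comm 1 k)) nat₁
      _ = (Ext.mk₀ f).comp (A'.comp P' (Nat.add_comm 1 k)) (zero_add (k + 1)) :=
          Ext.comp_assoc (Ext.mk₀ f) A' P' (zero_add 1) (Nat.add_comm 1 k) (by omega)

/-- **Naturality of `x ⋆ At'(E)^k` in the module** (the argument of `σ_k`): for `x ∈ Extⁿ(E'', E)` and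
`f : E → E'`, `(x ⋆ At'(E)^k) · multiHomMap f k = (x · f) ⋆ At'(E')^k`. [cite: BuchweitzFlenner2003, Def. 4.1 and §3] -/
theorem atiyahPowComp_naturality {n : ℕ} (x : Ext.{w} E'' E n) (k : ℕ) :
    (atiyahPowComp hΩ E x k).comp (Ext.mk₀ (multiHomMap f k)) (add_zero (n + k)) =
      atiyahPowComp hΩ E' (x.comp (Ext.mk₀ f) (add_zero n)) k :=
  calc (atiyahPowComp hΩ E x k).comp (Ext.mk₀ (multiHomMap f k)) (add_zero (n + k))
      = x.comp ((atiyahPow hΩ E k).comp (Ext.mk₀ (multiHomMap f k)) (add_zero k)) rfl :=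
        Ext.comp_assoc_of_third_deg_zero x _ _ rfl
    _ = x.comp ((Ext.mk₀ f).comp (atiyahPow.{w} hΩ E' k) (zero_add k)) rfl :=
        congrArg (fun t => x.comp t rfl) (atiyahPow_naturality f hΩ k)
    _ = (x.comp (Ext.mk₀ f) (add_zero n)).comp (atiyahPow.{w} hΩ E' k) rfl :=
        (Ext.comp_assoc_of_second_deg_zero x (Ext.mk₀ f) _ rfl).symm

end Powers

end Literature.AlgebraicGeometry.HodgeTheory

end
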